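import Summits.Ventures.LatticeQCDFlow.Scaling.IdealStarFreshness

/-!
HONEST FRAMING: exact (Metropolis-corrected) sampling algorithms for lattice gauge theory; figures
of merit are autocorrelation/cost numbers at stated couplings and volumes; no continuum-physics
claim.

# IdealStarStaleStructure — THE CONFIGURATION OF THE IDEALISED STAR SEEN THROUGH ITS STALE SET: FROM THE START WITH EVERY LEVEL AT `u`, STALE POSITIONS SHOW `u`, AND A WEIGHT
# THAT IS FRESH-EXCHANGEABLE OFF `D` (`ρ(z[k↦v])·ν(z_k) = ρ(z)·ν(v)`, `k ∉ D` — CHAPTER L FILE 14's PROPERTY OF THE AUGMENTED LAW, AND OF `ν^{⊗(K+1)}` WITH `D = ∅`) MAKES EVERY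
# CLEAN COORDINATE EXACTLY `ν`-DISTRIBUTED GIVEN THE OTHERS: THE CLEAN `u`-COUNT HAS MEAN `N'ν(u)` AND SQUARE DEVIATION `N'ν(u)(1−ν(u))`, `N' = K+1−|D|` (lean-2 GEN-45, ours)

Venture-side (OURS).  Cell `lqcd-flow` (pub-lqcd), unit `pub-lqcd-lean-2-g45`, 2026-08-31.  Chapter AE, file 6 — structure for file 7's law-free floor.  Objects of chapter L files 13–14
(the idealised hot-only hub: hub list `(0, κ_r+1)`, identity maps, one positive law `ν` at every level, exact hot sampler `M_0(u,·) = ν`; the augmented chain `P̂` on (configuration, stale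
set) by the hypothesis-equation `hPh`).

* §1 **`ideal_lawAt_stale_const`** — from `δ_{(u⃗, univ)}`: `λ_n(z, D) ≠ 0 ⇒ z_k = u` for every `k ∈ D` (stale positions hold primordial particles, all of content `u`).
* §2 (an abstract weight `ρ` on configurations, fresh-exchangeable off `D`): `fresh_point` (`ρ(w)ν(a) = ρ(w[k↦a])ν(v)` when `w_k = v`), `sum_filter_update` (the bijection `w ↦ w[k↦a]`
  between `{w_k = v}` and `{z_k = a}`), **`fresh_coord_indicator`** — `Σ_w 𝟙{w_k = v}ρ(w)g(w) = ν(v)·Σ_z ρ(z)g(z)` for every `g` blind to coordinate `k ∉ D`.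
* §3 the clean `u`-count `B_D(z) = Σ_{k∉D} 𝟙{z_k = u}`: **`fresh_count_mean`** (`Σρ·B = N'ν(u)·Σρ`), `fresh_count_pair`, **`fresh_count_sqdev`** (`Σρ·(B − N'ν(u))² = N'ν(u)(1−ν(u))·Σρ`),
  **`fresh_count_chebyshev`** (`ρ ≥ 0`, `c > 0`: `Σ_{(B−N'ν)² ≥ c} ρ ≤ (N'ν(1−ν)/c)·Σρ`).

Reading (no numerics implied): conditionally on the stale set the clean levels of the idealised star are an i.i.d. `ν`-sample (chapter L file 14), so the `u`-count of the configuration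
is `|D_n|` plus a binomial; file 7 turns this and file 5's survival of the stale cold levels into the law-free `½·log K` floor for two contents.  Literature grade (cell rule): OWN,
elementary (second-moment method); nothing cited as a fact; no new bib keys.
-/

noncomputable section

open Finset Function
open Literature.Probability.MarkovChains

namespace Summit.Ventures.LatticeQCDFlow.Scaling

/-! ## §1 Stale positions show the start -/

section Support
variable {S : Type*} [Fintype S] [DecidableEq S] {K m : ℕ} (κ : Fin m → Fin K) {ν : S → ℝ} {M : Fin (K + 1) → S → S → ℝ} {t : ℝ}

/-- **FROM THE ALL-`u` START, STALE POSITIONS SHOW `u`:** `λ_n(z, D) ≠ 0 ⇒ ∀ k ∈ D, z_k = u` for the augmented chain started at `((u,…,u), univ)`. [ours] -/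
theorem ideal_lawAt_stale_const
    {Ph : (Fin (K + 1) → S) × Finset (Fin (K + 1)) → (Fin (K + 1) → S) × Finset (Fin (K + 1)) → ℝ}
    (hPh : ∀ p q, Ph p q = ∑ r : Fin m, t / m *
        (if q.1 = edgeFlowSwap (Equiv.refl S) 0 (κ r).succ p.1 ∧ q.2 = p.2.image (Equiv.swap (0 : Fin (K + 1)) (κ r).succ)
          then (1 : ℝ) else 0)
      + (1 - t) * (coordKernel M 0 p.1 q.1 * (if q.2 = p.2.erase 0 then (1 : ℝ) else 0)))
    (u : S) : ∀ (n : ℕ) (z : Fin (K + 1) → S) (D : Finset (Fin (K + 1))),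
      lawAt Ph (Pi.single ((fun _ : Fin (K + 1) => u), (univ : Finset (Fin (K + 1)))) 1) n (z, D) ≠ 0 → ∀ k ∈ D, z k = u := by
  have he := hubList_fst_ne_snd (K := K) κ
  intro n
  induction n with
  | zero =>
      intro z D h k _
      rw [lawAt_zero] at h
      by_cases hz : ((z, D) : (Fin (K + 1) → S) × Finset (Fin (K + 1))) = ((fun _ : Fin (K + 1) => u), (univ : Finset (Fin (K + 1))))
      · have := congrArg Prod.fst hz
        exact congrFun this k
      · exact absurd (by rw [Pi.single_apply, if_neg hz]) h
  | succ n ih =>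
      intro z' D' h k hk
      rw [lawAt_succ, ideal_stepLaw_apply κ hPh] at h
      by_contra hne
      apply h
      -- every term vanishes
      have hsw : ∀ r : Fin m, lawAt Ph (Pi.single ((fun _ : Fin (K + 1) => u), (univ : Finset (Fin (K + 1)))) 1) n
          (edgeFlowSwap (Equiv.refl S) 0 (κ r).succ z', D'.image (Equiv.swap (0 : Fin (K + 1)) (κ r).succ)) = 0 := by
        intro r
        by_contra hr
        have hk' : Equiv.swap (0 : Fin (K + 1)) (κ r).succ k ∈ D'.image (Equiv.swap (0 : Fin (K + 1)) (κ r).succ) := mem_image_of_mem _ hk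
        have := ih _ _ hr _ hk'
        rw [edgeFlowSwap_one (he r), Function.comp_apply, Equiv.swap_apply_self] at this
        exact hne this
      have href : ∀ D ∈ univ.filter (fun D : Finset (Fin (K + 1)) => D.erase 0 = D'), ∀ u' : S,
          lawAt Ph (Pi.single ((fun _ : Fin (K + 1) => u), (univ : Finset (Fin (K + 1)))) 1) n (update z' 0 u', D) = 0 := by
        intro D hD u'
        have hD' : D.erase 0 = D' := (mem_filter.mp hD).2
        by_contra hr
        have hkD : k ∈ D := by rw [← hD'] at hk; exact (mem_erase.mp hk).2
        have hk0 : k ≠ 0 := by rw [← hD'] at hk; exact (mem_erase.mp hk).1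
        have := ih _ _ hr _ hkD
        rw [update_of_ne hk0] at this
        exact hne this
      rw [sum_eq_zero fun r _ => by rw [hsw r, mul_zero], zero_add]
      rw [sum_eq_zero fun D hD => sum_eq_zero fun u' _ => by rw [href D hD u', zero_mul], mul_zero]

end Support

/-! ## §2 A fresh-exchangeable weight: every clean coordinate is `ν` given the others -/

section Fresh
variable {S : Type*} [Fintype S] [DecidableEq S] {K : ℕ} {ν : S → ℝ} {ρ : (Fin (K + 1) → S) → ℝ} {D : Finset (Fin (K + 1))}

omit [Fintype S] [DecidableEq S] in
/-- **Pointwise:** `w_k = v`, `k ∉ D` ⇒ `ρ(w)·ν(a) = ρ(w[k↦a])·ν(v)`. [ours] -/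
theorem fresh_point [DecidableEq S] (hρ : ∀ (z : Fin (K + 1) → S) (k : Fin (K + 1)) (v : S), k ∉ D → ρ (update z k v) * ν (z k) = ρ z * ν v)
    {k : Fin (K + 1)} (hk : k ∉ D) {w : Fin (K + 1) → S} {v : S} (hw : w k = v) (a : S) : ρ w * ν a = ρ (update w k a) * ν v := by
  have h := hρ (update w k a) k (w k) hk
  rw [update_idem, update_eq_self, update_self, hw] at h
  exact h

omit [Fintype S] in
/-- **The bijection `w ↦ w[k↦a]` between `{w_k = v}` and `{z_k = a}`:** `Σ_w 𝟙{w_k = v}·G(w[k↦a]) = Σ_z 𝟙{z_k = a}·G(z)`. [ours] -/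
theorem sum_filter_update [Fintype S] (G : (Fin (K + 1) → S) → ℝ) (k : Fin (K + 1)) (v a : S) :
    ∑ w ∈ univ.filter (fun w : Fin (K + 1) → S => w k = v), G (update w k a) = ∑ z ∈ univ.filter (fun z : Fin (K + 1) → S => z k = a), G z := by
  refine Finset.sum_nbij' (fun w => update w k a) (fun z => update z k v) ?_ ?_ ?_ ?_ ?_
  · intro w _; exact mem_filter.mpr ⟨mem_univ _, by rw [update_self]⟩
  · intro z _; exact mem_filter.mpr ⟨mem_univ _, by rw [update_self]⟩
  · intro w hw
    have hwk : w k = v := (mem_filter.mp hw).2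
    rw [update_idem, ← hwk, update_eq_self]
  · intro z hz
    have hzk : z k = a := (mem_filter.mp hz).2
    rw [update_idem, ← hzk, update_eq_self]
  · intro w _; rfl

/-- **EVERY CLEAN COORDINATE IS `ν` GIVEN THE OTHERS:** for `k ∉ D`, `Σν = 1` and every `g` blind to coordinate `k`, **`Σ_w 𝟙{w_k = v}·ρ(w)·g(w) = ν(v)·Σ_z ρ(z)·g(z)`**. [ours] -/
theorem fresh_coord_indicator (hρ : ∀ (z : Fin (K + 1) → S) (k : Fin (K + 1)) (v : S), k ∉ D → ρ (update z k v) * ν (z k) = ρ z * ν v)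
    (hν1 : ∑ a, ν a = 1) {k : Fin (K + 1)} (hk : k ∉ D) {g : (Fin (K + 1) → S) → ℝ} (hg : ∀ z a, g (update z k a) = g z) (v : S) :
    ∑ w, (if w k = v then (1 : ℝ) else 0) * (ρ w * g w) = ν v * ∑ z, ρ z * g z := by
  classical
  -- `ρ(w) = ν(v)·Σ_a ρ(w[k↦a])` on `{w_k = v}`
  have hpt : ∀ w : Fin (K + 1) → S, w k = v → ρ w = ν v * ∑ a, ρ (update w k a) := by
    intro w hw
    have : ρ w * ∑ a, ν a = ∑ a, ρ (update w k a) * ν v := by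
      rw [mul_sum]; exact sum_congr rfl fun a _ => fresh_point hρ hk hw a
    rw [hν1, mul_one] at this
    rw [this, ← sum_mul, mul_comm]
  rw [show (∑ w, (if w k = v then (1 : ℝ) else 0) * (ρ w * g w)) = ∑ w ∈ univ.filter (fun w : Fin (K + 1) → S => w k = v), ρ w * g w by
    rw [Finset.sum_filter]; exact sum_congr rfl fun w _ => by split_ifs <;> simp]
  calc ∑ w ∈ univ.filter (fun w : Fin (K + 1) → S => w k = v), ρ w * g w
      = ∑ w ∈ univ.filter (fun w : Fin (K + 1) → S => w k = v), ν v * ∑ a, ρ (update w k a) * g (update w k a) := by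
        refine sum_congr rfl fun w hw => ?_
        have hwk : w k = v := (mem_filter.mp hw).2
        rw [hpt w hwk, mul_assoc, sum_mul]
        congr 1; exact sum_congr rfl fun a _ => by rw [hg]
    _ = ν v * ∑ a, ∑ w ∈ univ.filter (fun w : Fin (K + 1) → S => w k = v), ρ (update w k a) * g (update w k a) := by
        rw [← mul_sum, sum_comm]
    _ = ν v * ∑ a, ∑ z ∈ univ.filter (fun z : Fin (K + 1) → S => z k = a), ρ z * g z := by
        congr 1; exact sum_congr rfl fun a _ => sum_filter_update (fun z => ρ z * g z) k v a
    _ = ν v * ∑ z, ρ z * g z := by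
        congr 1
        rw [← Finset.sum_fiberwise_of_maps_to (s := (univ : Finset (Fin (K + 1) → S))) (t := (univ : Finset S)) (g := fun z => z k) (fun z _ => mem_univ _)]

/-! ## §3 The clean `u`-count: mean, square deviation, Chebyshev -/

/-- **THE MEAN:** `Σ_z ρ(z)·B_D(z) = N'·ν(u)·Σ_z ρ(z)`, `B_D(z) = Σ_{k∉D} 𝟙{z_k = u}`, `N' = |univ ∖ D|`. [ours] -/
theorem fresh_count_mean (hρ : ∀ (z : Fin (K + 1) → S) (k : Fin (K + 1)) (v : S), k ∉ D → ρ (update z k v) * ν (z k) = ρ z * ν v)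
    (hν1 : ∑ a, ν a = 1) (u : S) :
    ∑ z, ρ z * ∑ k ∈ univ \ D, (if z k = u then (1 : ℝ) else 0) = ((univ \ D).card : ℝ) * ν u * ∑ z, ρ z := by
  classical
  rw [show (∑ z, ρ z * ∑ k ∈ univ \ D, (if z k = u then (1 : ℝ) else 0)) = ∑ k ∈ univ \ D, ∑ z, (if z k = u then (1 : ℝ) else 0) * (ρ z * 1) by
    rw [sum_comm]; exact sum_congr rfl fun z _ => by rw [mul_sum]; exact sum_congr rfl fun k _ => by ring]
  rw [sum_congr rfl fun k hk => fresh_coord_indicator hρ hν1 (Finset.mem_sdiff.mp hk).2 (g := fun _ => (1 : ℝ)) (fun _ _ => rfl) u]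
  rw [sum_const, nsmul_eq_mul]
  simp only [mul_one]
  ring

/-- **THE PAIR CORRELATIONS:** for `k, l ∉ D`: `Σ_z ρ(z)𝟙{z_k = u}𝟙{z_l = u} = ν(u)·Σρ` if `k = l`, `= ν(u)²·Σρ` if `k ≠ l`. [ours] -/
theorem fresh_count_pair (hρ : ∀ (z : Fin (K + 1) → S) (k : Fin (K + 1)) (v : S), k ∉ D → ρ (update z k v) * ν (z k) = ρ z * ν v)
    (hν1 : ∑ a, ν a = 1) (u : S) {k l : Fin (K + 1)} (hk : k ∉ D) (hl : l ∉ D) :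
    ∑ z, ρ z * ((if z k = u then (1 : ℝ) else 0) * (if z l = u then (1 : ℝ) else 0)) = (if k = l then ν u else ν u * ν u) * ∑ z, ρ z := by
  classical
  by_cases hkl : k = l
  · subst hkl
    rw [if_pos rfl]
    have e : ∀ z : Fin (K + 1) → S, ρ z * ((if z k = u then (1 : ℝ) else 0) * (if z k = u then (1 : ℝ) else 0)) = (if z k = u then (1 : ℝ) else 0) * (ρ z * 1) := by
      intro z; split_ifs <;> ring
    rw [sum_congr rfl fun z _ => e z, fresh_coord_indicator hρ hν1 hk (g := fun _ => (1 : ℝ)) (fun _ _ => rfl) u]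
    simp only [mul_one]
  · rw [if_neg hkl]
    have e : ∀ z : Fin (K + 1) → S, ρ z * ((if z k = u then (1 : ℝ) else 0) * (if z l = u then (1 : ℝ) else 0)) = (if z k = u then (1 : ℝ) else 0) * (ρ z * (if z l = u then (1 : ℝ) else 0)) := by
      intro z; ring
    rw [sum_congr rfl fun z _ => e z, fresh_coord_indicator hρ hν1 hk (g := fun z => if z l = u then (1 : ℝ) else 0) (fun z a => by rw [update_of_ne (Ne.symm hkl)]) u]
    have e2 : ∀ z : Fin (K + 1) → S, ρ z * (if z l = u then (1 : ℝ) else 0) = (if z l = u then (1 : ℝ) else 0) * (ρ z * 1) := by intro z; ring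
    rw [sum_congr rfl fun z _ => e2 z, fresh_coord_indicator hρ hν1 hl (g := fun _ => (1 : ℝ)) (fun _ _ => rfl) u]
    simp only [mul_one]; ring

/-- **THE SQUARE DEVIATION:** `Σ_z ρ(z)·(B_D(z) − N'ν(u))² = N'·ν(u)(1−ν(u))·Σ_z ρ(z)`. [ours] -/
theorem fresh_count_sqdev (hρ : ∀ (z : Fin (K + 1) → S) (k : Fin (K + 1)) (v : S), k ∉ D → ρ (update z k v) * ν (z k) = ρ z * ν v)
    (hν1 : ∑ a, ν a = 1) (u : S) :
    ∑ z, ρ z * (∑ k ∈ univ \ D, (if z k = u then (1 : ℝ) else 0) - ((univ \ D).card : ℝ) * ν u) ^ 2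
      = ((univ \ D).card : ℝ) * (ν u * (1 - ν u)) * ∑ z, ρ z := by
  classical
  set N' : ℝ := ((univ \ D).card : ℝ) with hN'
  -- expand the square
  have hsq : ∀ z : Fin (K + 1) → S, ρ z * (∑ k ∈ univ \ D, (if z k = u then (1 : ℝ) else 0) - N' * ν u) ^ 2
      = ρ z * (∑ k ∈ univ \ D, ∑ l ∈ univ \ D, (if z k = u then (1 : ℝ) else 0) * (if z l = u then (1 : ℝ) else 0))
        - 2 * (N' * ν u) * (ρ z * ∑ k ∈ univ \ D, (if z k = u then (1 : ℝ) else 0)) + (N' * ν u) ^ 2 * ρ z := by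
    intro z
    rw [sub_sq, sq, Finset.sum_mul_sum]
    ring
  rw [sum_congr rfl fun z _ => hsq z, sum_add_distrib, sum_sub_distrib, ← mul_sum, ← mul_sum, fresh_count_mean hρ hν1 u]
  -- the double sum
  have hdouble : ∑ z, ρ z * ∑ k ∈ univ \ D, ∑ l ∈ univ \ D, (if z k = u then (1 : ℝ) else 0) * (if z l = u then (1 : ℝ) else 0)
      = (N' * ν u + (N' * N' - N') * (ν u * ν u)) * ∑ z, ρ z := by
    have hswap : ∑ z, ρ z * ∑ k ∈ univ \ D, ∑ l ∈ univ \ D, (if z k = u then (1 : ℝ) else 0) * (if z l = u then (1 : ℝ) else 0)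
        = ∑ k ∈ univ \ D, ∑ l ∈ univ \ D, ∑ z, ρ z * ((if z k = u then (1 : ℝ) else 0) * (if z l = u then (1 : ℝ) else 0)) := by
      simp_rw [mul_sum]
      rw [sum_comm]
      refine sum_congr rfl fun k _ => ?_
      rw [sum_comm]
    rw [hswap, sum_congr rfl fun k hk => sum_congr rfl fun l hl => fresh_count_pair hρ hν1 u (Finset.mem_sdiff.mp hk).2 (Finset.mem_sdiff.mp hl).2]
    simp_rw [← sum_mul]
    congr 1
    -- `Σ_{k,l} [k = l] ν + [k ≠ l] ν² = N'ν + (N'² − N')ν²`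
    have hinner : ∀ k ∈ univ \ D, ∑ l ∈ univ \ D, (if k = l then ν u else ν u * ν u) = ν u + (N' - 1) * (ν u * ν u) := by
      intro k hk
      rw [← Finset.add_sum_erase _ _ hk, if_pos rfl]
      congr 1
      rw [sum_congr rfl fun l hl => if_neg (Finset.ne_of_mem_erase hl).symm, sum_const, nsmul_eq_mul, Finset.card_erase_of_mem hk]
      congr 1
      rw [hN', Nat.cast_sub (Finset.card_pos.mpr ⟨k, hk⟩)]; simp
    rw [sum_congr rfl hinner, sum_const, nsmul_eq_mul]
    ring
  rw [hdouble, ← hN']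
  ring

/-- **CHEBYSHEV FOR THE CLEAN `u`-COUNT:** `ρ ≥ 0`, `c > 0` ⇒ `Σ_{z : (B_D(z) − N'ν(u))² ≥ c} ρ(z) ≤ (N'ν(u)(1−ν(u))/c)·Σ_z ρ(z)`. [ours] -/
theorem fresh_count_chebyshev (hρ : ∀ (z : Fin (K + 1) → S) (k : Fin (K + 1)) (v : S), k ∉ D → ρ (update z k v) * ν (z k) = ρ z * ν v)
    (hρ0 : ∀ z, 0 ≤ ρ z) (hν1 : ∑ a, ν a = 1) (u : S) {c : ℝ} (hc : 0 < c) :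
    ∑ z ∈ univ.filter (fun z : Fin (K + 1) → S => c ≤ (∑ k ∈ univ \ D, (if z k = u then (1 : ℝ) else 0) - ((univ \ D).card : ℝ) * ν u) ^ 2), ρ z
      ≤ ((univ \ D).card : ℝ) * (ν u * (1 - ν u)) / c * ∑ z, ρ z := by
  classical
  rw [div_mul_eq_mul_div, le_div_iff₀ hc, ← fresh_count_sqdev hρ hν1 u]
  calc (∑ z ∈ univ.filter (fun z : Fin (K + 1) → S => c ≤ (∑ k ∈ univ \ D, (if z k = u then (1 : ℝ) else 0) - ((univ \ D).card : ℝ) * ν u) ^ 2), ρ z) * c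
      = ∑ z ∈ univ.filter (fun z : Fin (K + 1) → S => c ≤ (∑ k ∈ univ \ D, (if z k = u then (1 : ℝ) else 0) - ((univ \ D).card : ℝ) * ν u) ^ 2), ρ z * c := sum_mul _ _ _
    _ ≤ ∑ z ∈ univ.filter (fun z : Fin (K + 1) → S => c ≤ (∑ k ∈ univ \ D, (if z k = u then (1 : ℝ) else 0) - ((univ \ D).card : ℝ) * ν u) ^ 2),
          ρ z * (∑ k ∈ univ \ D, (if z k = u then (1 : ℝ) else 0) - ((univ \ D).card : ℝ) * ν u) ^ 2 :=
        sum_le_sum fun z hz => mul_le_mul_of_nonneg_left (mem_filter.mp hz).2 (hρ0 z)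
    _ ≤ ∑ z, ρ z * (∑ k ∈ univ \ D, (if z k = u then (1 : ℝ) else 0) - ((univ \ D).card : ℝ) * ν u) ^ 2 :=
        sum_le_sum_of_subset_of_nonneg (filter_subset _ _) fun z _ _ => mul_nonneg (hρ0 z) (sq_nonneg _)

end Fresh

end Summit.Ventures.LatticeQCDFlow.Scaling

end
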